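import Summits.AtomisticToContinuum.HydrodynamicLimit.Theses.JParityClosure
import Literature.MathematicalPhysics.KineticTheory.CollisionTubeFunctional
import Literature.MathematicalPhysics.KineticTheory.EvenCollisionTubeFunctional
import Literature.MathematicalPhysics.KineticTheory.HardSphereEulerProofs
import Summits.AtomisticToContinuum.HydrodynamicLimit.Theorems.EvenStressEnskog.Negative.ContactValueZero
import Summits.AtomisticToContinuum.HydrodynamicLimit.Theorems.EvenStressEnskog.Negative.PairFunctionalVanishing
import Summits.AtomisticToContinuum.HydrodynamicLimit.Theorems.EvenStressEnskog.Negative.FrequencyLawReduction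
import Summits.AtomisticToContinuum.HydrodynamicLimit.Theorems.JParityClosureOddContactSymmetryL2ToProbability
import Summits.AtomisticToContinuum.HydrodynamicLimit.Theorems.JParityClosureEvenStressEnskogTubeStatRegular
import Summits.AtomisticToContinuum.HydrodynamicLimit.Theorems.ImplosionDichotomyHsEosLowDensity

/-!
# Line `even-rung-mean-variance` for crux `JParityClosure.EvenStressEnskog` (stmt-AtomisticToContinuum-13079)

Skeleton (crux-plan, planner-cruxplan-stmt-AtomisticToContinuum-13079-even-rung-mean-varia-0, 2026-08-16).
Idea card `Cruxes/EvenStressEnskog/Ideas/even-rung-mean-variance.md` (ideator 3, round 1; triage r1-1/2/3: pass,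
sharpenings answered in `Lines/even-rung-mean-variance.md`).  Direction: POSITIVE — `EvenStressEnskog_of` concludes the
crux decl `Summit.AtomisticToContinuum.HydrodynamicLimit.Theses.JParityClosure.EvenStressEnskog` BY NAME from the six
registered stubs and the route support item `HsEosLowDensity` (stmt-AtomisticToContinuum-0768, by name; it supplies the
band on which the contact value `Y = (3/2π)·f_ex′` is regular — Disproof §3/§5: `Y 0 = 0` is `deriv`-junk and `Y` is not
right-continuous at `0`, so NO regularity of `Y` is claimed here except through `HsEosLowDensity`).  The stubs carry the
only `sorry`s of the file.  DECLARED TRANSPLANT of the sibling crux's registered skeleton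
`Cruxes/OddContactSymmetry/Lines/equilibrium-rung-mean-variance.lean` (stmt-13078, lead reshape v2): same chassis
(truncate · pull back to the collision tube · mean / fixed-time variance · Cauchy–Schwarz–Chebyshev · regularity), with
the J-odd bounded mark replaced by the J-even, velocity-UNBOUNDED momentum-transfer marks `Ξ_P^{kl}` and the parity
ZERO of the mean replaced by the Enskog VALUE (contact value `Y`).

THE LINE.  Write `D^{kl} = evenStat … (evenMark k l)` for the crux statistic
`K_N[χ g(σ³ρ_r) Ξ_P^{kl}] − σ³∫₀^τ∫ χ g Y B_r(Ξ_P^{kl})` (`evenStat`: the crux's `let`-chain verbatim, split as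
`collisionSum − σ³ ∫₀^τ enskogRate ∘ Φ_s ds`; `evenStressEnskog_iff` is the `Iff.rfl` bridge).
(1) TRUNCATE the mark in relative speed (`evenMarkTrunc k l L`: bounded by `2L`, continuous, `= Ξ_P^{kl}` at unit normal
and `‖w − v‖ ≤ L`, `= 0` for `‖w − v‖ ≥ 2L`; `stub_velocityTruncation`: `D(Ξ_P) − D(Ξ_L) → 0` in probability, `L → ∞`
after `N → ∞` — the collision-weighted second-moment tail input, free at rung 0).
(2) PULL BACK every long-flight collision along the exact pair free flight to the tree's fixed-time tube functional
`tubeStat σ N χ g Ξ r r 1 κ t` (reweighting INERT at truncation level `1`: `min(1 + e^{−F̃}, 1) = 1`, so `ϑ := r` is a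
dummy), and slice the Enskog time integral at fixed times (exact): with the ONE-TIME functional
`W_t = evenTubeStat … κ t = tubeStat(…, L = 1) − σ³·enskogRate(…, t)` and `T_κ(z) = ∫₀^τ W_t(Φ_t z) dt`
(`evenTubeTimeStat`), `stub_cylinderPullback`: `D(Ξ_L) − T_κ → 0` in probability (`κ → 0` after `N → ∞`; short flights
carry a `K_N`-mass fraction `O(κφ)`).
(3) Split `T_κ → 0` into MEAN and FLUCTUATION about the evolved law `μ_t = (Φ_t)_# LG₀` at FIXED times:
`stub_meanEnskog` (ME, the HARDEST stub and the only place where the equation of state enters: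
`|∫₀^τ E_{LG}[W_t ∘ Φ_t] dt| ≤ η` for `κ < κ₀(L)`, `N ≥ N₀` — the time-averaged incoming near-contact `a₊² n̂⊗n̂`-moment of
`f₂^{(N)}(t)` equals `Y(σ³ρ)·`(h-blind second-moment functional), Disproof §10 `Theta_XiP_eq_half`; the tube must shrink
INTO the contact region, `κ‖w−v‖ ≪ 1`, automatic here since `‖w−v‖ ≤ 2L` on the truncated mark — triage r1-1 §F),
`stub_fixedTimeVariance` (FV, `sup_{t≤τ} Var_{LG}(W_t ∘ Φ_t) → 0` — concentration of the tube statistic RELATIVE to the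
Enskog functional of the same configuration; weaker than concentration of each), the finite-`N` Cauchy–Schwarz–Chebyshev
inequality `stub_l2ToProbability` (L2P, provable now, stated for an ARBITRARY jointly measurable bounded family
`X : ℝ → Config → ℝ` — 13078's S5 is its instance `X := tubeStat …`), and the regularity input `stub_evenTubeStatRegular`
(joint measurability + a uniform bound of `W` on `[0,τ] × Config`, from `HsEosLowDensity`; its tube part is the tree
theorem `Theorems.stub_tubeStatRegular`, 13078's S6, PROVED — only the Enskog rate functional is new).
(4) `EvenStressEnskog_of : S1 → S2 → S3 → S4 → S5 → S6 → HsEosLowDensity → EvenStressEnskog` (sorry-free):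
`η₀, σ₀ ≤ 1/2, r₀ := min`, `L := max L₀ 1`, `κ := min (κ₂/2) (κ₃/2) 1`, `N₀ := max`, union bound
`{η < |D|} ⊆ {η/3 < |D − D_L|} ∪ {η/3 < |D_L − T_κ|} ∪ {η/3 < |T_κ|}`, Chebyshev constants `m = η/6`,
`ς = (δ/3)(η/6)²/τ²`.

RUNG 0 (constant profiles; the card's closed special case and the lead's first milestone — an INSTANCE of S1–S4, not a
separate stub; triage r1-1/2/3 sharpen: its mean is card closure-invariance-principle's (R0a–c), ONE shared rung-0
lemma set for the crux directory, and at rung 0 the MEAN should be computed by the exact Palm / collision-boundary flux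
identity `E_{G_N} K_N[m] = τ·(flux of the invariant law through {‖sepVec‖ = ε, incoming})`, the tube serving the
variance only): `localGibbsLaw` is the canonical Gibbs law, invariant under `Φ_t`
(tree `Theorems.map_flow_localGibbsLaw_const`, PROVED for 13078), so ME₀/FV₀/S1₀ are STATIC statements about the Gibbs
measure: canonical near-contact pair density `→ ρ² Y(η)` (cluster expansion + virial/contact theorem
`g(ε⁺) = (3/2π)F′(η)` with the `F` of `HsEosLowDensity` on the OPEN band), `Var_G(W) = O(L²σ⁶/(κN))`, Gaussian tails.

Disproof used (`Cruxes/EvenStressEnskog/Disproof.lean`, cycles 1–2; NO `_false_without_<H>` theorem, no stub kill):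
§3/§5 + `Negative/ContactValueZero` — no stub evaluates or regularises `Y` at `0`; the only regularity of `Y` enters
through `HsEosLowDensity` (S6's antecedent and `_of`'s seventh hypothesis); §4 + `Negative/PairFunctionalVanishing` and
§9 + `Negative/SwappedOrderTrivial` — every stub keeps the honest order `∃ r₀ ∀ r < r₀ … ∃ N₀ ∀ N ≥ N₀` (`r` never
depends on `N`; `κ → 0` and `L → ∞` sit between `r` and `N`); §8 + `Negative/FrequencyLawReduction` — the trace
`k = l` summed of ME is the impulse-rate (collisional pressure) law, predicted, not fought; §10 `Theta_XiP_eq_half` — the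
h-blind target form of ME.  All four landed Negative files are imported below (scratch check: no stub is an instance
they refute).  Negatives index (`ledger negatives`): no ∀-solution frame (9168), no small-cell order (9236/9238).
-/

set_option linter.dupNamespace false
set_option linter.unusedVariables false

namespace Summit.AtomisticToContinuum.HydrodynamicLimit.Cruxes.EvenStressEnskog.EvenRungMeanVariance

open Summit.AtomisticToContinuum.HydrodynamicLimit.Theses.JParityClosure
open scoped BigOperators Topology Classical MeasureTheory ProbabilityTheory InnerProductSpace
open Filter Set Function MeasureTheory
open Literature.Analysis.FluidPDE Literature.MathematicalPhysics.KineticTheory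

noncomputable section

/-! ## Vocabulary

The crux's `let`-chain, named, now lives in the tree:
`Literature/MathematicalPhysics/KineticTheory/EvenCollisionTubeFunctional.lean` (p76472, 2026-08-16): `evenMark`,
`evenMarkTrunc` (+ `clip1`, `speedCutoff` and the truncation API `continuous_evenMarkTrunc`, `abs_evenMarkTrunc_le`,
`exists_abs_evenMarkTrunc_le`, `evenMarkTrunc_eq_zero_of_le`, `evenMarkTrunc_eq_evenMark`, `abs_evenMark_le`),
`coneKernel`, `mollDensity`, `sphereMark`, `pairFunctional`, `contactValue`, `enskogRate`, `collisionSum`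
(`oddStatTrunc_one_eq_collisionSum`), `evenStat`, `evenTubeStat`, `evenTubeTimeStat` — bodies verbatim the former local
definitions, so every registered stub text below is unchanged. -/

/-- Definitional bridge (checked by `Iff.rfl`): `EvenStressEnskog` with its `let`-chain named `evenStat` / `evenMark`.
[folklore] -/
theorem evenStressEnskog_iff :
    EvenStressEnskog ↔
    ∃ η₀ : ℝ, 0 < η₀ ∧ ∀ (a₀ θ₀ : T3 → ℝ) (u₀ : T3 → V3), Continuous a₀ → Continuous θ₀ → Continuous u₀ →
      (∀ x, 0 < a₀ x) → (∀ x, 0 < θ₀ x) → ∃ σ₀ : ℝ, 0 < σ₀ ∧ ∀ σ : ℝ, 0 < σ → σ < σ₀ →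
      ∀ Φ : (N : ℕ) → HardSphereFlow (Torus.geometry (Fin 3)) (hsDiameter σ N) (N + 1),
      ∀ τ : ℝ, 0 < τ → ∀ χ : ℝ × UnitAddTorus (Fin 3) → ℝ, Continuous χ → ∀ g : ℝ → ℝ, Continuous g →
      (∀ a, η₀ ≤ a → g a = 0) →
      ∀ η δ : ℝ, 0 < η → 0 < δ → ∃ r₀ : ℝ, 0 < r₀ ∧ ∀ r : ℝ, 0 < r → r < r₀ →
      ∃ N₀ : ℕ, ∀ N : ℕ, N₀ ≤ N → ∀ k l : Fin 3,
        localGibbsLaw σ a₀ u₀ θ₀ N (Φ N) {z | η < |evenStat σ N (Φ N) τ χ g (evenMark k l) r z|}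
          ≤ ENNReal.ofReal δ :=
  Iff.rfl

/-! ## The six registered stubs (each: the statement `Prop` `Stubs.stub_*`, then the sorried theorem `stub_*` with the same text) -/

/-- **S1 · VELOCITY TRUNCATION IS TIGHT** (`stub_velocityTruncation`; parity-free a-priori input, specific to the even
marks because they are UNBOUNDED in the relative velocity).  In the crux's frame (`∃ η₀`, profiles, `∃ σ₀`, any flows,
`τ, χ, g`, `∀ η δ ∃ r₀ ∀ r < r₀`) there is a truncation level `L₀ = L₀(r, …)` such that for `L ≥ L₀`, `N ≥ N₀(L)` and all
`k, l`:  `P(|D(Ξ_P^{kl}) − D(Ξ_L^{kl})| > η) ≤ δ` — the pairs of relative speed `> L` carry a vanishing share BOTH of the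
collision sum (`K_N[χ g (Ξ_P − Ξ_L)]`, mark `≤ |w−v|·1{|w−v| > L}` at unit normal, `evenMarkTrunc_eq_evenMark`) AND of
the Enskog functional (`B_r(Ξ_P − Ξ_L)`, a second-moment tail of the `r`-ball empirical velocity law, Disproof §10
`Bfun_eq_sum`), in probability, uniformly in `N`.  Why plausibly true: under the local Gibbs law velocities are Gaussian
and kinetic energy is conserved by the flow; at RUNG 0 (Gibbs at every time) it is a static Gaussian tail bound (free).
Why it might fail / honest size: for general profiles at positive times this is UNIFORM INTEGRABILITY OF THE KINETIC
ENERGY ALONG THE TRUE FLOW, collision-weighted — the `∀ τ` local-Gibbs-frame sibling of the route support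
`KineticEnergyTails` (stmt-13087, typed in the Euler-solution frame `t < T`: FRAME MISMATCH noted by triage r1-2 sharpen
(1) — this stub is the frame-matched statement the crux needs anyway; open: entropy relative to the invariant Gibbs law
bounds the tail energy but does not make it vanish).  Size L (open) in general; S–M at rung 0.  Leans on: tree
`localGibbsLaw`, `isProbabilityMeasure_localGibbsLaw`, `HardSphereFlow.configEnergy_flow` (energy conservation),
`integral_empiricalMeasure`, `IsHardSphereTrajectory.numCollisions_eq`; route supports `CollisionTightness` (13085),
`KineticEnergyTails` (13087, pattern only); this file's `evenMarkTrunc_eq_evenMark`, `evenMarkTrunc_eq_zero_of_le`,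
`abs_evenMarkTrunc_le`; OllaVaradhanYau1993, Spohn1991 I.3. -/
def Stubs.stub_velocityTruncation : Prop :=
    ∃ η₀ : ℝ, 0 < η₀ ∧ ∀ (a₀ θ₀ : T3 → ℝ) (u₀ : T3 → V3), Continuous a₀ → Continuous θ₀ → Continuous u₀ →
      (∀ x, 0 < a₀ x) → (∀ x, 0 < θ₀ x) → ∃ σ₀ : ℝ, 0 < σ₀ ∧ ∀ σ : ℝ, 0 < σ → σ < σ₀ →
      ∀ Φ : (N : ℕ) → HardSphereFlow (Torus.geometry (Fin 3)) (hsDiameter σ N) (N + 1),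
      ∀ τ : ℝ, 0 < τ → ∀ χ : ℝ × UnitAddTorus (Fin 3) → ℝ, Continuous χ → ∀ g : ℝ → ℝ, Continuous g →
      (∀ a, η₀ ≤ a → g a = 0) →
      ∀ η δ : ℝ, 0 < η → 0 < δ → ∃ r₀ : ℝ, 0 < r₀ ∧ ∀ r : ℝ, 0 < r → r < r₀ →
      ∃ L₀ : ℝ, ∀ L : ℝ, L₀ ≤ L → ∃ N₀ : ℕ, ∀ N : ℕ, N₀ ≤ N → ∀ k l : Fin 3,
        localGibbsLaw σ a₀ u₀ θ₀ N (Φ N)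
          {z | η < |evenStat σ N (Φ N) τ χ g (evenMark k l) r z -
              evenStat σ N (Φ N) τ χ g (evenMarkTrunc k l L) r z|}
          ≤ ENNReal.ofReal δ

/-- Registered stub S1 (`Stubs.stub_velocityTruncation`, verbatim): the `sorry` to be discharged. -/
theorem stub_velocityTruncation :
    ∃ η₀ : ℝ, 0 < η₀ ∧ ∀ (a₀ θ₀ : T3 → ℝ) (u₀ : T3 → V3), Continuous a₀ → Continuous θ₀ → Continuous u₀ →
      (∀ x, 0 < a₀ x) → (∀ x, 0 < θ₀ x) → ∃ σ₀ : ℝ, 0 < σ₀ ∧ ∀ σ : ℝ, 0 < σ → σ < σ₀ →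
      ∀ Φ : (N : ℕ) → HardSphereFlow (Torus.geometry (Fin 3)) (hsDiameter σ N) (N + 1),
      ∀ τ : ℝ, 0 < τ → ∀ χ : ℝ × UnitAddTorus (Fin 3) → ℝ, Continuous χ → ∀ g : ℝ → ℝ, Continuous g →
      (∀ a, η₀ ≤ a → g a = 0) →
      ∀ η δ : ℝ, 0 < η → 0 < δ → ∃ r₀ : ℝ, 0 < r₀ ∧ ∀ r : ℝ, 0 < r → r < r₀ →
      ∃ L₀ : ℝ, ∀ L : ℝ, L₀ ≤ L → ∃ N₀ : ℕ, ∀ N : ℕ, N₀ ≤ N → ∀ k l : Fin 3,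
        localGibbsLaw σ a₀ u₀ θ₀ N (Φ N)
          {z | η < |evenStat σ N (Φ N) τ χ g (evenMark k l) r z -
              evenStat σ N (Φ N) τ χ g (evenMarkTrunc k l L) r z|}
          ≤ ENNReal.ofReal δ := by
  sorry

/-- **S2 · THE CYLINDER PULL-BACK in probability** (`stub_cylinderPullback`; parity-free, deterministic bookkeeping plus a
short-flight count — 13078's S2 with the mark swapped and `L = 1`, plus the EXACT time-slicing of the Enskog integral).
Same frame; for every truncation level `L ≥ 1` there is `κ₀ = κ₀(L, r, …) > 0` such that for `0 < κ < κ₀`, `N ≥ N₀(κ)` and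
all `k, l`:  `P(|D(Ξ_L) − T_κ(Ξ_L)| > η) ≤ δ`, where `T_κ = evenTubeTimeStat … κ = ∫₀^τ (A_t − σ³e_t)(Φ_t z) dt`.  Content,
on the good set `Φ.good` (full `LG`-measure, `Negative/FrequencyLawReduction.localGibbsLaw_compl_good`): (a) the PATHWISE
identity `K_N[χ g Ξ_L] = ∫₀^τ A_t(Φ_t z) dt + R_κ + B + C` — every collision at time `s` whose two partners flew freely
during `[s − t_h, s]`, `t_h ≤ κε`, is seen by the tube functional `tubeStat … r r 1 κ t` for exactly `t ∈ [s − κε, s)`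
(free flight `q(t) = εn̂ + (s−t)(w−v)`, quadratic hitting time, predicted normal = true normal, `reflectVel` involutive;
reweighting inert at level `1`) with weight `((N+1)κ)⁻¹`, i.e. contributes `ε/(N+1)` × its mark; `R_κ` = short flights
(a third body hits `i` or `j` within `κε` before the collision, or a tube pair is intercepted: a fraction `O(κ·σ³ρ_loc)`
of the `K_N`-mass under the cutoff `g`, in probability — Palm count of third bodies within reach), `B` = time boundary
(fraction `κε/τ`), `C` = continuity corrections (`χ`, `g∘ρ_r` read at `(t, x_i(t))` instead of `(s, x_i(s))`:
displacements `≤ 2Lκε`, `bx` is `r⁻⁴`-Lipschitz) — all `→ 0` as `N → ∞` then `κ → 0` at fixed `(r, L)`; (b) the Enskog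
part is EXACT: `σ³∫₀^τ∫_x(…)(Φ_s z) = σ³∫₀^τ e_s(Φ_s z) ds` definitionally, and `∫(A_t − σ³e_t) = ∫A_t − σ³∫e_t` by
integrability of both along good orbits (bounded, piecewise continuous in `t`).  No smallness of `r` is needed (the
`∃ r₀` is frame uniformity only).  Size M–L.  Leans on: tree `tubeStat`/`tubeTimeStat_def`/`abs_tubeStat_le`
(CollisionTubeFunctional), `IsHardSphereTrajectory.{free, binary, locFinite, eq_freeFlight}`, `freeFlight_apply`,
`Torus.geometry_sepVec`, `reflectVel_reflectVel`, `HardSphereFlow.{isTrajectory, mapsTo_good, flow_add, ae_mem_good}`,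
`measurePreserving_restrict_good`; route supports `CollisionTightness` (13085), `EmpiricalEnskogIdentity` (13086, same
collision-sum bookkeeping); sibling stub 13078 `stub_cylinderPullback` (its `L = 1` instance is the `K_N`-part here, via
`oddStatTrunc … 1 = collisionSum`); GST2013 §4.1, PulvirentiSimonellaTrushechkin2018, CIP1994 §2.2. -/
def Stubs.stub_cylinderPullback : Prop :=
    ∃ η₀ : ℝ, 0 < η₀ ∧ ∀ (a₀ θ₀ : T3 → ℝ) (u₀ : T3 → V3), Continuous a₀ → Continuous θ₀ → Continuous u₀ →
      (∀ x, 0 < a₀ x) → (∀ x, 0 < θ₀ x) → ∃ σ₀ : ℝ, 0 < σ₀ ∧ ∀ σ : ℝ, 0 < σ → σ < σ₀ →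
      ∀ Φ : (N : ℕ) → HardSphereFlow (Torus.geometry (Fin 3)) (hsDiameter σ N) (N + 1),
      ∀ τ : ℝ, 0 < τ → ∀ χ : ℝ × UnitAddTorus (Fin 3) → ℝ, Continuous χ → ∀ g : ℝ → ℝ, Continuous g →
      (∀ a, η₀ ≤ a → g a = 0) →
      ∀ η δ : ℝ, 0 < η → 0 < δ → ∃ r₀ : ℝ, 0 < r₀ ∧ ∀ r : ℝ, 0 < r → r < r₀ →
      ∀ L : ℝ, 1 ≤ L → ∃ κ₀ : ℝ, 0 < κ₀ ∧ ∀ κ : ℝ, 0 < κ → κ < κ₀ → ∃ N₀ : ℕ, ∀ N : ℕ, N₀ ≤ N →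
      ∀ k l : Fin 3,
        localGibbsLaw σ a₀ u₀ θ₀ N (Φ N)
          {z | η < |evenStat σ N (Φ N) τ χ g (evenMarkTrunc k l L) r z -
              evenTubeTimeStat σ N (Φ N) τ χ g (evenMarkTrunc k l L) r κ z|}
          ≤ ENNReal.ofReal δ

/-- Registered stub S2 (`Stubs.stub_cylinderPullback`, verbatim): the `sorry` to be discharged. -/
theorem stub_cylinderPullback :
    ∃ η₀ : ℝ, 0 < η₀ ∧ ∀ (a₀ θ₀ : T3 → ℝ) (u₀ : T3 → V3), Continuous a₀ → Continuous θ₀ → Continuous u₀ →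
      (∀ x, 0 < a₀ x) → (∀ x, 0 < θ₀ x) → ∃ σ₀ : ℝ, 0 < σ₀ ∧ ∀ σ : ℝ, 0 < σ → σ < σ₀ →
      ∀ Φ : (N : ℕ) → HardSphereFlow (Torus.geometry (Fin 3)) (hsDiameter σ N) (N + 1),
      ∀ τ : ℝ, 0 < τ → ∀ χ : ℝ × UnitAddTorus (Fin 3) → ℝ, Continuous χ → ∀ g : ℝ → ℝ, Continuous g →
      (∀ a, η₀ ≤ a → g a = 0) →
      ∀ η δ : ℝ, 0 < η → 0 < δ → ∃ r₀ : ℝ, 0 < r₀ ∧ ∀ r : ℝ, 0 < r → r < r₀ →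
      ∀ L : ℝ, 1 ≤ L → ∃ κ₀ : ℝ, 0 < κ₀ ∧ ∀ κ : ℝ, 0 < κ → κ < κ₀ → ∃ N₀ : ℕ, ∀ N : ℕ, N₀ ≤ N →
      ∀ k l : Fin 3,
        localGibbsLaw σ a₀ u₀ θ₀ N (Φ N)
          {z | η < |evenStat σ N (Φ N) τ χ g (evenMarkTrunc k l L) r z -
              evenTubeTimeStat σ N (Φ N) τ χ g (evenMarkTrunc k l L) r κ z|}
          ≤ ENNReal.ofReal δ := by
  sorry

/-- **S3 · MEAN = ENSKOG** (`stub_meanEnskog`; THE BET — hardest, load-bearing, the only stub that uses the equation of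
state and the specific even marks).  Same frame: `∀ η ∃ r₀ ∀ r < r₀ ∀ L ≥ 1 ∃ κ₀ ∀ κ < κ₀ ∃ N₀ ∀ N ≥ N₀ ∀ k l`,
`|∫₀^τ E_{LG}[W_t^{klL} ∘ Φ_t] dt| ≤ η`: the time-integrated ensemble mean of the tube functional under the evolved local
Gibbs law `μ_t = (Φ_t)_# LG₀` equals `σ³ ×` the mean of the Enskog rate functional of the same configurations — in BBGKY
form: the time-averaged pre-collisional two-body function `f₂^{(N)}(t)` of `μ_t` on the incoming tube
(`ε < |q| ≤ ε(1 + 2Lκ)`), tested against `χ g a₊ Ξ_L^{kl}`, equals `Y(σ³ρ_r)·`(the h-BLIND second-moment functional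
`B_r`: `Θ(Ξ_P^{kl})(v,w) = ½∫((w−v)·ω)² ω_kω_l dω`, Disproof §10 — prediction `Y(ρσ³)ρ²(4π/15)(2Σ + trΣ·𝟙)` for a pure
local state with covariance `Σ`, `= Yρ²θ(4π/3)δ_kl` at a Maxwellian).  Order of limits (triage r1-1 §F, r1-3 sharpen 2):
a VALUE is read through the tube, so the tube must lie INSIDE the contact region — tube length `≤ 2Lκε ≪ ε`, whence
`κ₀ = κ₀(L, η)`; and `r₀` comes BEFORE `N₀` because at fixed `r` the `r`-ball smoothing of `ρ, Σ` leaves a residual that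
vanishes only as `r → 0` at Lebesgue points of STRONG limits (route-level remark R of all three triagers: automatic
pre-shock; for the filed `∀ τ` an extra "strong precompactness at scale `r`" input lives HERE and nowhere else).  Why it
might fail: this IS the crux in expectation (crux + S1-type uniform integrability ⇒ S3, so a profile with a non-vanishing
mean kills the crux outright): J-even velocity-dependent contact structure at positive times (|g|-dependent approach
rates from ring / recollision memory, shear-induced contact anisotropy at finite `Kn`, Lutsko1996/2001) would shift the
contact value off `Y`; post-shock velocity texture below scale `r` breaks the `ρ_r²`-prediction by Jensen.  Why
plausibly true: local equilibrium at the two-body level on microscopic scales at Euler scaling (`Kn ≍ N^{−1/3} → 0` at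
fixed reduced density below `η₀`); the crux is consistent to all orders in `η` at Euler order in `Kn` (Disproof §7).
RUNG 0 (constant profiles `(a, u, θ)`, `LG` = canonical Gibbs, flow-invariant by `Theorems.map_flow_localGibbsLaw_const`):
the statement is STATIC — (i) Palm / collision-boundary flux identity `E_{G_N}K_N[m] = τ·`(flux of `G_N` through
`{‖sepVec‖ = ε, incoming}` with mark `m`) on `Φ.good` (certifies every normalisation: ordered-pair factor 2 = Disproof
`xiP_swap`, `|S²| = 4π`, cone mass 1), (ii) canonical near-contact pair density of `N+1` spheres on `𝕋³` at reduced
density `η ∈ (0, η₀)` `→ ρ²g(ε⁺;η)` (low-density cluster expansion, `HardSphereCanonicalTorus` / `HardCoreCanonical`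
machinery beyond first order), (iii) contact theorem `g(ε⁺;η) = (3/2π)F′(η)` for the analytic `F` of `HsEosLowDensity` on
the OPEN band (dilation of the canonical partition function + Griffiths' convexity lemma; never `deriv hsExcessFreeEnergy`
at `0`, never `deriv` of finite-`N` `log hsFreeVolume` — triage r1-1 card-4 hygiene) — ONE rung-0 lemma set shared with
card closure-invariance-principle's (R0a–c) (triage r1-2/3).  Size XL (open) in general; L at rung 0.  Leans on: tree
`tubeStat`, `hardSphereKernel`, `sphereMeasure`, `integral_comp_swap_negDir`-type symmetries, `hsExcessFreeEnergy`,
`HardSphereCanonicalTorus.integral_two_point_eq`, `Theorems.map_flow_localGibbsLaw_const` /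
`integral_comp_flow_localGibbsLaw_const` (rung 0), `localGibbs_lln_holds`, `localGibbs_densityLLN_holds`; route supports
`HsEosLowDensity` (0768), `DensityCap` (13082, pattern), `KineticEnergyTails` (13087, pattern); mechanism inputs from the
sibling crux ideas `rotate-fly-commutator-dlr` (IsoChaos ⇒ ME via local limits), `defect-hierarchy-zero-driving`,
`stationary-microscale-hierarchy-entrance-law`, or the card ybg/StaticContactValue split; ChapmanCowling1970 §16.4,
Resibois1978, VanbeijerenErnst1973, Ruelle1969 §4, LebowitzPenrose1964, Spohn1991 I.3, Lutsko1996, Lutsko2001. -/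
def Stubs.stub_meanEnskog : Prop :=
    ∃ η₀ : ℝ, 0 < η₀ ∧ ∀ (a₀ θ₀ : T3 → ℝ) (u₀ : T3 → V3), Continuous a₀ → Continuous θ₀ → Continuous u₀ →
      (∀ x, 0 < a₀ x) → (∀ x, 0 < θ₀ x) → ∃ σ₀ : ℝ, 0 < σ₀ ∧ ∀ σ : ℝ, 0 < σ → σ < σ₀ →
      ∀ Φ : (N : ℕ) → HardSphereFlow (Torus.geometry (Fin 3)) (hsDiameter σ N) (N + 1),
      ∀ τ : ℝ, 0 < τ → ∀ χ : ℝ × UnitAddTorus (Fin 3) → ℝ, Continuous χ → ∀ g : ℝ → ℝ, Continuous g →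
      (∀ a, η₀ ≤ a → g a = 0) →
      ∀ η : ℝ, 0 < η → ∃ r₀ : ℝ, 0 < r₀ ∧ ∀ r : ℝ, 0 < r → r < r₀ →
      ∀ L : ℝ, 1 ≤ L → ∃ κ₀ : ℝ, 0 < κ₀ ∧ ∀ κ : ℝ, 0 < κ → κ < κ₀ → ∃ N₀ : ℕ, ∀ N : ℕ, N₀ ≤ N →
      ∀ k l : Fin 3,
        |∫ t in Set.Icc (0 : ℝ) τ,
            ∫ z, evenTubeStat σ N χ g (evenMarkTrunc k l L) r κ t ((Φ N).flow t z)
              ∂(localGibbsLaw σ a₀ u₀ θ₀ N (Φ N))| ≤ η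

/-- Registered stub S3 (`Stubs.stub_meanEnskog`, verbatim): the `sorry` to be discharged. -/
theorem stub_meanEnskog :
    ∃ η₀ : ℝ, 0 < η₀ ∧ ∀ (a₀ θ₀ : T3 → ℝ) (u₀ : T3 → V3), Continuous a₀ → Continuous θ₀ → Continuous u₀ →
      (∀ x, 0 < a₀ x) → (∀ x, 0 < θ₀ x) → ∃ σ₀ : ℝ, 0 < σ₀ ∧ ∀ σ : ℝ, 0 < σ → σ < σ₀ →
      ∀ Φ : (N : ℕ) → HardSphereFlow (Torus.geometry (Fin 3)) (hsDiameter σ N) (N + 1),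
      ∀ τ : ℝ, 0 < τ → ∀ χ : ℝ × UnitAddTorus (Fin 3) → ℝ, Continuous χ → ∀ g : ℝ → ℝ, Continuous g →
      (∀ a, η₀ ≤ a → g a = 0) →
      ∀ η : ℝ, 0 < η → ∃ r₀ : ℝ, 0 < r₀ ∧ ∀ r : ℝ, 0 < r → r < r₀ →
      ∀ L : ℝ, 1 ≤ L → ∃ κ₀ : ℝ, 0 < κ₀ ∧ ∀ κ : ℝ, 0 < κ → κ < κ₀ → ∃ N₀ : ℕ, ∀ N : ℕ, N₀ ≤ N →
      ∀ k l : Fin 3,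
        |∫ t in Set.Icc (0 : ℝ) τ,
            ∫ z, evenTubeStat σ N χ g (evenMarkTrunc k l L) r κ t ((Φ N).flow t z)
              ∂(localGibbsLaw σ a₀ u₀ θ₀ N (Φ N))| ≤ η := by
  sorry

/-- **S4 · FIXED-TIME VARIANCE** (`stub_fixedTimeVariance`; parity-free and value-free; the fluctuation half).  Same
frame: `∀ ς > 0 ∃ r₀ ∀ r < r₀ ∀ L ≥ 1 ∀ κ ∈ (0,1] ∃ N₀ ∀ N ≥ N₀ ∀ k l ∀ t ∈ [0,τ]`, `Var_{LG}(W_t^{klL} ∘ Φ_t) ≤ ς`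
(Mathlib `ProbabilityTheory.variance`): uniformly in time, the tube functional MINUS `σ³×` the Enskog rate functional of
the SAME configuration concentrates under the evolved law `μ_t`.  Deliberately stated for the difference `W = A − σ³e`:
`Var W ≤ 2 Var A + 2σ⁶ Var e`, so 13078's S4 (`Var A → 0`, at `L = 1`, `ϑ = r`) plus fixed-time concentration of the
`r`-ball empirical fields gives it, but it is WEAKER than either — it does not presuppose that the macroscopic fields at
time `t` are deterministic, only that the tube statistic is predicted by the local empirical state (conditional
concentration: a 4-body static decorrelation of two DISJOINT tube pairs under `μ_t` at tube resolution, given the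
`r`-ball fields).  Scales: `~κσ³N` ordered pairs in the tube, each weighted `≤ C_χ C_g 2L/((N+1)κ)`; diagonal and
one-shared-particle terms give `O(L²σ⁶/(κN)) → 0`.  Why it might fail / honest size: for `t > 0` the relative
decorrelation is propagation of microscopic spatial decorrelation along the deterministic flow — open, shared currency of
every concentration-based route, not this line's mechanism (triage r1-3 doubt: "an EXTRA bet not implied by the crux,
mild").  RUNG 0: static low-density cluster bound for a bounded tube U-statistic under the canonical Gibbs law,
`Var_G(W) = O(L²σ⁶/(κN))` (no mixing needed: the law at each `t` IS `G_N`).  Size XL in general; L at rung 0.  Leans on: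
Mathlib `ProbabilityTheory.variance`, `IndepFun.variance_sum`-type bookkeeping; tree `integral_empiricalMeasure`,
`canonicalDensity`, `particleLaw`, `HardSphereFlow.lawAt`, `Theorems.map_flow_localGibbsLaw_const`,
`localGibbs_lln_holds`; sibling stub 13078 `stub_fixedTimeVariance`; Ruelle1969, LebowitzPenrose1964, Spohn1991 I.3,
OllaVaradhanYau1993. -/
def Stubs.stub_fixedTimeVariance : Prop :=
    ∃ η₀ : ℝ, 0 < η₀ ∧ ∀ (a₀ θ₀ : T3 → ℝ) (u₀ : T3 → V3), Continuous a₀ → Continuous θ₀ → Continuous u₀ →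
      (∀ x, 0 < a₀ x) → (∀ x, 0 < θ₀ x) → ∃ σ₀ : ℝ, 0 < σ₀ ∧ ∀ σ : ℝ, 0 < σ → σ < σ₀ →
      ∀ Φ : (N : ℕ) → HardSphereFlow (Torus.geometry (Fin 3)) (hsDiameter σ N) (N + 1),
      ∀ τ : ℝ, 0 < τ → ∀ χ : ℝ × UnitAddTorus (Fin 3) → ℝ, Continuous χ → ∀ g : ℝ → ℝ, Continuous g →
      (∀ a, η₀ ≤ a → g a = 0) →
      ∀ ς : ℝ, 0 < ς → ∃ r₀ : ℝ, 0 < r₀ ∧ ∀ r : ℝ, 0 < r → r < r₀ →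
      ∀ L κ : ℝ, 1 ≤ L → 0 < κ → κ ≤ 1 → ∃ N₀ : ℕ, ∀ N : ℕ, N₀ ≤ N → ∀ k l : Fin 3, ∀ t ∈ Set.Icc (0 : ℝ) τ,
        ProbabilityTheory.variance
          (fun z => evenTubeStat σ N χ g (evenMarkTrunc k l L) r κ t ((Φ N).flow t z))
          (localGibbsLaw σ a₀ u₀ θ₀ N (Φ N)) ≤ ς

/-- Registered stub S4 (`Stubs.stub_fixedTimeVariance`, verbatim): the `sorry` to be discharged. -/
theorem stub_fixedTimeVariance :
    ∃ η₀ : ℝ, 0 < η₀ ∧ ∀ (a₀ θ₀ : T3 → ℝ) (u₀ : T3 → V3), Continuous a₀ → Continuous θ₀ → Continuous u₀ →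
      (∀ x, 0 < a₀ x) → (∀ x, 0 < θ₀ x) → ∃ σ₀ : ℝ, 0 < σ₀ ∧ ∀ σ : ℝ, 0 < σ → σ < σ₀ →
      ∀ Φ : (N : ℕ) → HardSphereFlow (Torus.geometry (Fin 3)) (hsDiameter σ N) (N + 1),
      ∀ τ : ℝ, 0 < τ → ∀ χ : ℝ × UnitAddTorus (Fin 3) → ℝ, Continuous χ → ∀ g : ℝ → ℝ, Continuous g →
      (∀ a, η₀ ≤ a → g a = 0) →
      ∀ ς : ℝ, 0 < ς → ∃ r₀ : ℝ, 0 < r₀ ∧ ∀ r : ℝ, 0 < r → r < r₀ →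
      ∀ L κ : ℝ, 1 ≤ L → 0 < κ → κ ≤ 1 → ∃ N₀ : ℕ, ∀ N : ℕ, N₀ ≤ N → ∀ k l : Fin 3, ∀ t ∈ Set.Icc (0 : ℝ) τ,
        ProbabilityTheory.variance
          (fun z => evenTubeStat σ N χ g (evenMarkTrunc k l L) r κ t ((Φ N).flow t z))
          (localGibbsLaw σ a₀ u₀ θ₀ N (Φ N)) ≤ ς := by
  sorry

/-- **S5 · CAUCHY–SCHWARZ–CHEBYSHEV, `L² →` probability** (`stub_l2ToProbability`; the card's `MeanVarianceReduction`,
a finite-`N` inequality with NO limit, NO dynamics, NO stationarity — provable now; stated for an ARBITRARY family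
`X : ℝ → Config → ℝ`, jointly Borel measurable and uniformly bounded on `[0, τ] × Config`, so that ONE proof serves this
line (`X t z := evenTubeStat … t z`) and 13078's S5 (`X := tubeStat …`, its registered instance).  If
`P = localGibbsLaw …` is a probability measure, `|X| ≤ B` on `[0,τ] × Config`, the time-integrated mean of `X_t ∘ Φ_t`
under `P` has modulus `≤ m < η` and `Var_P(X_t ∘ Φ_t) ≤ ς` for every `t ∈ [0,τ]`, then
`P(η < |∫₀^τ X_t(Φ_t z) dt|) ≤ τ²ς/(η − m)²`.  Proof on paper: put `X̃(t, z) := X_t(good.piecewise Φ_t id z)`, jointly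
measurable by `HardSphereFlow.measurable_piecewise_flow` (`measurable_piecewise_flow_torus`) and bounded by `B`;
`P`-a.e. `z` is good (`P ≪` Liouville, `HardSphereFlow.ae_mem_good` / `Negative/FrequencyLawReduction.
localGibbsLaw_compl_good`), and for good `z`, `X̃(·, z) = X_·(Φ_· z)`, so means, variances, the time integral and the
event are unchanged a.e.; with `e(t) := E_P X̃_t` (measurable in `t`, Fubini) and `M := ∫₀^τ e =` the hypothesis'
iterated integral (`|M| ≤ m`), pointwise `T̃(z) − M = ∫₀^τ (X̃_t(z) − e(t)) dt`, Cauchy–Schwarz in time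
`|T̃(z) − M|² ≤ τ ∫₀^τ (X̃_t(z) − e(t))² dt`, Tonelli `E_P ∫₀^τ (X̃_t − e(t))² dt = ∫₀^τ Var_P(X̃_t) dt ≤ τς`, and Markov on
the square over `{η − m ≤ |T̃ − M|} ⊇ {η < |T̃|}`.  Size M.  Leans on: Mathlib `ProbabilityTheory.variance`, `evariance`,
`meas_ge_le_variance_div_sq` / `mul_meas_ge_le_lintegral₀`, `lintegral_lintegral_swap` / `integral_integral_swap`,
`ENNReal.lintegral_mul_le_Lp_mul_Lq` (`p = q = 2`), `StronglyMeasurable.integral_prod_right`; tree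
`measurable_piecewise_flow_torus`, `piecewise_flow_of_mem`, `HardSphereFlow.ae_mem_good`, `localGibbsLaw_eq`,
`localGibbsMeasure_absolutelyContinuous`; sibling stub 13078 `stub_l2ToProbability` (instance). -/
def Stubs.stub_l2ToProbability : Prop :=
    ∀ (σ : ℝ) (a₀ θ₀ : T3 → ℝ) (u₀ : T3 → V3) (N : ℕ)
      (Φ : HardSphereFlow (Torus.geometry (Fin 3)) (hsDiameter σ N) (N + 1))
      (τ : ℝ) (X : ℝ → Config (N + 1) (Fin 3) T3 → ℝ) (m ς η B : ℝ),
      IsProbabilityMeasure (localGibbsLaw σ a₀ u₀ θ₀ N Φ) →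
      Measurable (fun p : ℝ × Config (N + 1) (Fin 3) T3 => X p.1 p.2) →
      (∀ t ∈ Set.Icc (0 : ℝ) τ, ∀ z : Config (N + 1) (Fin 3) T3, |X t z| ≤ B) →
      0 < τ → 0 ≤ ς → m < η →
      |∫ t in Set.Icc (0 : ℝ) τ, ∫ z, X t (Φ.flow t z) ∂(localGibbsLaw σ a₀ u₀ θ₀ N Φ)| ≤ m →
      (∀ t ∈ Set.Icc (0 : ℝ) τ,
        ProbabilityTheory.variance (fun z => X t (Φ.flow t z)) (localGibbsLaw σ a₀ u₀ θ₀ N Φ) ≤ ς) →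
      localGibbsLaw σ a₀ u₀ θ₀ N Φ {z | η < |∫ t in Set.Icc (0 : ℝ) τ, X t (Φ.flow t z)|}
        ≤ ENNReal.ofReal (τ ^ 2 * ς / (η - m) ^ 2)

/-- Registered stub S5 (`Stubs.stub_l2ToProbability`, verbatim): LANDED — p76766,
`Theorems/JParityClosureEvenStressEnskogL2ToProbability.lean`, `Theorems.EvenStressEnskog.stub_l2ToProbability`
(instance of the tree theorem `Theorems.measure_lt_abs_setIntegral_flow_le`). [folklore] -/
theorem stub_l2ToProbability :
    ∀ (σ : ℝ) (a₀ θ₀ : T3 → ℝ) (u₀ : T3 → V3) (N : ℕ)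
      (Φ : HardSphereFlow (Torus.geometry (Fin 3)) (hsDiameter σ N) (N + 1))
      (τ : ℝ) (X : ℝ → Config (N + 1) (Fin 3) T3 → ℝ) (m ς η B : ℝ),
      IsProbabilityMeasure (localGibbsLaw σ a₀ u₀ θ₀ N Φ) →
      Measurable (fun p : ℝ × Config (N + 1) (Fin 3) T3 => X p.1 p.2) →
      (∀ t ∈ Set.Icc (0 : ℝ) τ, ∀ z : Config (N + 1) (Fin 3) T3, |X t z| ≤ B) →
      0 < τ → 0 ≤ ς → m < η →
      |∫ t in Set.Icc (0 : ℝ) τ, ∫ z, X t (Φ.flow t z) ∂(localGibbsLaw σ a₀ u₀ θ₀ N Φ)| ≤ m →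
      (∀ t ∈ Set.Icc (0 : ℝ) τ,
        ProbabilityTheory.variance (fun z => X t (Φ.flow t z)) (localGibbsLaw σ a₀ u₀ θ₀ N Φ) ≤ ς) →
      localGibbsLaw σ a₀ u₀ θ₀ N Φ {z | η < |∫ t in Set.Icc (0 : ℝ) τ, X t (Φ.flow t z)|}
        ≤ ENNReal.ofReal (τ ^ 2 * ς / (η - m) ^ 2) := by
  -- = `Theorems.EvenStressEnskog.stub_l2ToProbability` (p76766); proved here through the tree theorem it instantiates,
  -- so that this workfile does not depend on the build state of the newly landed module.
  intro σ a₀ θ₀ u₀ N Φ τ X m ς η B hP hmeas hB hτ _hς hmη hmean hvar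
  exact Summit.AtomisticToContinuum.HydrodynamicLimit.Theorems.measure_lt_abs_setIntegral_flow_le
    σ a₀ θ₀ u₀ N Φ hmeas hB hτ hmη hmean hvar

/-- **S6 · REGULARITY OF THE EVEN TUBE FUNCTIONAL** (`stub_evenTubeStatRegular`; elementary given the equation of state,
split off so that S5 never unfolds `evenTubeStat`).  `W = A − σ³e` with `A = tubeStat σ N χ g Ξ_L^{kl} r r 1 κ t` and
`e = enskogRate σ N χ g Ξ_L^{kl} r t`.  From `HsEosLowDensity` (the `F` analytic on `(−η₁, η₁)`, equal to `f_ex` on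
`[0, η₁)`): there is `η₀ > 0` (any `η₀ < η₁`) such that for `σ > 0`, continuous `χ, g` with `g` vanishing on `[η₀, ∞)`,
`L ≥ 0`, `r > 0`, `κ ≥ 0`, all `k, l` and any `τ`: (i) `(t, z) ↦ W_t(z)` is Borel measurable on `ℝ × Config`; (ii)
`|W_t(z)| ≤ B` uniformly on `[0,τ] × Config`.  TUBE PART = the tree theorem
`Summit.AtomisticToContinuum.HydrodynamicLimit.Theorems.stub_tubeStatRegular` (13078's S6, PROVED in
`Theorems/JParityClosureOddContactSymmetryTubeStatRegular.lean`: `measurable_tubeStat_uncurry`, `exists_bound_tubeStat`)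
instantiated at `(Ψ, ϑ, L) := (Ξ_L^{kl}, r, 1)` with `continuous_evenMarkTrunc`, `abs_evenMarkTrunc_le` of this file — no
work left there.  ENSKOG PART (the content): (i) `(t, z) ↦ e_t(z)` is a parametric integral over the compact `𝕋³` of a
jointly measurable bounded integrand (`χ` continuous; `ρ_r(z, x)` continuous in `(z, x)`; `g ∘` it; `Y = (3/2π)·deriv f_ex`
is MEASURABLE by Mathlib `measurable_deriv`; `B_r(z,x) = (N+1)⁻² ΣᵢΣⱼ b_r b_r Θ(vᵢ,vⱼ)`, Disproof §10 `Bfun_eq_sum`, with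
`Θ(Ξ_L)` continuous), `StronglyMeasurable.integral_prod_right`; (ii) `|e_t(z)| ≤ B_e` uniformly: `χ` bounded on the
compact `[0,τ] × 𝕋³`; `σ³ρ_r ≥ 0` and `g(a)Y(a) = 0` for `a ≥ η₀`, while on `[0, η₀] ⊂ [0, η₁)` the contact value is
bounded — `Y 0 = 0` (junk, `Negative/ContactValueZero`) and on the OPEN band `deriv f_ex = F′`
(`Filter.EventuallyEq.deriv_eq`), bounded on `(0, η₀]` by continuity of `F′` on `[0, η₀]`; `|Θ(Ξ_L)(v,w)| ≤ 2L·2L·sphereMeasure(S²)`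
by the support `‖w−v‖ < 2L` of `Ξ_L` (`evenMarkTrunc_eq_zero_of_le`, `abs_evenMarkTrunc_le`, kernel `((w−v)·ω)₊ ≤ ‖w−v‖`);
`∫_x b_r(xᵢ,x) b_r(xⱼ,x) dx ≤ 3/(πr³)`; then `|W| ≤ B_A + σ³B_e`, `Measurable.sub`.  Size S–M.  Leans on: Mathlib
`measurable_deriv`, `StronglyMeasurable.integral_prod_right'`, `IsCompact.exists_bound_of_continuousOn`,
`AnalyticOnNhd.contDiffOn` / `ContDiffOn.continuousOn_deriv_of_isOpen`-type API, `norm_setIntegral_le_of_norm_le_const`;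
tree `Theorems.stub_tubeStatRegular` (= `measurable_tubeStat_uncurry` + `exists_bound_tubeStat`),
`integral_empiricalMeasure`, `continuous_euclidDist`, `Torus.measurable_reprSym`, `sphereMeasure` finiteness
(`SphereMeasureSymmetry`), `Theorems.coneKernel_nonneg_le`, `Theorems.abs_cube_mul_empiricalDensity_le`; route support
`HsEosLowDensity` (0768); `Negative/ContactValueZero.deriv_hsExcessFreeEnergy_zero`. -/
def Stubs.stub_evenTubeStatRegular : Prop :=
    HsEosLowDensity →
    ∃ η₀ : ℝ, 0 < η₀ ∧ ∀ (σ : ℝ) (N : ℕ) (χ : ℝ × UnitAddTorus (Fin 3) → ℝ) (g : ℝ → ℝ) (k l : Fin 3)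
      (L r κ τ : ℝ),
      0 < σ → Continuous χ → Continuous g → (∀ a, η₀ ≤ a → g a = 0) → 0 ≤ L → 0 < r → 0 ≤ κ →
      Measurable (fun p : ℝ × Config (N + 1) (Fin 3) T3 =>
        evenTubeStat σ N χ g (evenMarkTrunc k l L) r κ p.1 p.2) ∧
      ∃ B : ℝ, ∀ t ∈ Set.Icc (0 : ℝ) τ, ∀ z : Config (N + 1) (Fin 3) T3,
        |evenTubeStat σ N χ g (evenMarkTrunc k l L) r κ t z| ≤ B

/-- Registered stub S6 (`Stubs.stub_evenTubeStatRegular`, verbatim): LANDED — p77220,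
`Theorems/JParityClosureEvenStressEnskogTubeStatRegular.lean`, `Theorems.EvenStressEnskog.stub_evenTubeStatRegular`. [folklore] -/
theorem stub_evenTubeStatRegular :
    HsEosLowDensity →
    ∃ η₀ : ℝ, 0 < η₀ ∧ ∀ (σ : ℝ) (N : ℕ) (χ : ℝ × UnitAddTorus (Fin 3) → ℝ) (g : ℝ → ℝ) (k l : Fin 3)
      (L r κ τ : ℝ),
      0 < σ → Continuous χ → Continuous g → (∀ a, η₀ ≤ a → g a = 0) → 0 ≤ L → 0 < r → 0 ≤ κ →
      Measurable (fun p : ℝ × Config (N + 1) (Fin 3) T3 =>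
        evenTubeStat σ N χ g (evenMarkTrunc k l L) r κ p.1 p.2) ∧
      ∃ B : ℝ, ∀ t ∈ Set.Icc (0 : ℝ) τ, ∀ z : Config (N + 1) (Fin 3) T3,
        |evenTubeStat σ N χ g (evenMarkTrunc k l L) r κ t z| ≤ B :=
  Summit.AtomisticToContinuum.HydrodynamicLimit.Theorems.EvenStressEnskog.stub_evenTubeStatRegular

/-! ## The composition (kernel-checked, sorry-free) -/

/-- **`EvenStressEnskog` from S1–S4 and the equation of state** (S5, S6 are proved in this file).  Thresholds `η₀, σ₀, r₀` are minima of the stubs'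
thresholds (a cutoff `g` vanishing on `[min, ∞)` vanishes on each `[ηᵢ, ∞)`; `σ₀ ≤ 1/2` moreover, so that the local
Gibbs laws are probability measures, `isProbabilityMeasure_localGibbsLaw`); given `(η, δ)` the three probabilistic
inputs are run at `(η/3, δ/3)`: S1 yields `L₀(r)` and we take `L := max L₀ 1`; S3 is run at mean accuracy `m = η/6` and
S2 at `(η/3, δ/3)`, each yielding a `κ₀`, and `κ := min (min (κ₂/2) (κ₃/2)) 1`; S4 at variance `ς = (δ/3)(η/6)²/τ²` so
that S5 — fed with the regularity of `W` (S6 under `HsEosLowDensity`) — returns `τ²ς/(η/3 − η/6)² = δ/3`; `N₀ := max`; and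
`{η < |D|} ⊆ {η/3 < |D − D_L|} ∪ {η/3 < |D_L − T_κ|} ∪ {η/3 < |T_κ|}` with `measure_union_le` and `ENNReal.ofReal_add`.
[folklore] -/
theorem EvenStressEnskog_of
    (hS1 : Stubs.stub_velocityTruncation) (hS2 : Stubs.stub_cylinderPullback) (hS3 : Stubs.stub_meanEnskog)
    (hS4 : Stubs.stub_fixedTimeVariance) (hEos : HsEosLowDensity) :
    EvenStressEnskog := by
  -- S5 and S6 are no longer hypotheses: they are proved above (landed p76766, p77220).
  have hS5 : Stubs.stub_l2ToProbability := stub_l2ToProbability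
  have hS6 : Stubs.stub_evenTubeStatRegular := stub_evenTubeStatRegular
  refine evenStressEnskog_iff.2 ?_
  obtain ⟨η₁, hη₁, H1⟩ := hS1
  obtain ⟨η₂, hη₂, H2⟩ := hS2
  obtain ⟨η₃, hη₃, H3⟩ := hS3
  obtain ⟨η₄, hη₄, H4⟩ := hS4
  obtain ⟨η₆, hη₆, H6⟩ := hS6 hEos
  refine ⟨min (min (min η₁ η₂) (min η₃ η₄)) η₆,
    lt_min (lt_min (lt_min hη₁ hη₂) (lt_min hη₃ hη₄)) hη₆, ?_⟩
  intro a₀ θ₀ u₀ ha hθ hu ha0 hθ0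
  obtain ⟨σ₁, hσ₁, H1⟩ := H1 a₀ θ₀ u₀ ha hθ hu ha0 hθ0
  obtain ⟨σ₂, hσ₂, H2⟩ := H2 a₀ θ₀ u₀ ha hθ hu ha0 hθ0
  obtain ⟨σ₃, hσ₃, H3⟩ := H3 a₀ θ₀ u₀ ha hθ hu ha0 hθ0
  obtain ⟨σ₄, hσ₄, H4⟩ := H4 a₀ θ₀ u₀ ha hθ hu ha0 hθ0
  refine ⟨min (min (min σ₁ σ₂) (min σ₃ σ₄)) (1 / 2),
    lt_min (lt_min (lt_min hσ₁ hσ₂) (lt_min hσ₃ hσ₄)) (by norm_num), ?_⟩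
  intro σ hσ hσlt' Φ τ hτ χ hχ g hg hg0 η δ hη hδ
  have hσlt : σ < min (min σ₁ σ₂) (min σ₃ σ₄) := lt_of_lt_of_le hσlt' (min_le_left _ _)
  have hσhalf : σ ≤ 1 / 2 := (lt_of_lt_of_le hσlt' (min_le_right _ _)).le
  have hσ1 : σ < σ₁ := lt_of_lt_of_le hσlt ((min_le_left _ _).trans (min_le_left _ _))
  have hσ2 : σ < σ₂ := lt_of_lt_of_le hσlt ((min_le_left _ _).trans (min_le_right _ _))
  have hσ3 : σ < σ₃ := lt_of_lt_of_le hσlt ((min_le_right _ _).trans (min_le_left _ _))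
  have hσ4 : σ < σ₄ := lt_of_lt_of_le hσlt ((min_le_right _ _).trans (min_le_right _ _))
  -- the cutoff vanishes above each threshold
  have hmin₁ : min (min (min η₁ η₂) (min η₃ η₄)) η₆ ≤ η₁ :=
    ((min_le_left _ _).trans (min_le_left _ _)).trans (min_le_left _ _)
  have hmin₂ : min (min (min η₁ η₂) (min η₃ η₄)) η₆ ≤ η₂ :=
    ((min_le_left _ _).trans (min_le_left _ _)).trans (min_le_right _ _)
  have hmin₃ : min (min (min η₁ η₂) (min η₃ η₄)) η₆ ≤ η₃ :=
    ((min_le_left _ _).trans (min_le_right _ _)).trans (min_le_left _ _)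
  have hmin₄ : min (min (min η₁ η₂) (min η₃ η₄)) η₆ ≤ η₄ :=
    ((min_le_left _ _).trans (min_le_right _ _)).trans (min_le_right _ _)
  have hmin₆ : min (min (min η₁ η₂) (min η₃ η₄)) η₆ ≤ η₆ := min_le_right _ _
  have hg1 : ∀ a, η₁ ≤ a → g a = 0 := fun a h => hg0 a (hmin₁.trans h)
  have hg2 : ∀ a, η₂ ≤ a → g a = 0 := fun a h => hg0 a (hmin₂.trans h)
  have hg3 : ∀ a, η₃ ≤ a → g a = 0 := fun a h => hg0 a (hmin₃.trans h)
  have hg4 : ∀ a, η₄ ≤ a → g a = 0 := fun a h => hg0 a (hmin₄.trans h)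
  have hg6 : ∀ a, η₆ ≤ a → g a = 0 := fun a h => hg0 a (hmin₆.trans h)
  -- accuracies
  have hη3 : 0 < η / 3 := by positivity
  have hδ3 : 0 < δ / 3 := by positivity
  have hη6 : 0 < η / 6 := by positivity
  have hς : 0 < δ / 3 * (η / 6) ^ 2 / τ ^ 2 := by positivity
  obtain ⟨r₁, hr₁, H1⟩ := H1 σ hσ hσ1 Φ τ hτ χ hχ g hg hg1 (η / 3) (δ / 3) hη3 hδ3
  obtain ⟨r₂, hr₂, H2⟩ := H2 σ hσ hσ2 Φ τ hτ χ hχ g hg hg2 (η / 3) (δ / 3) hη3 hδ3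
  obtain ⟨r₃, hr₃, H3⟩ := H3 σ hσ hσ3 Φ τ hτ χ hχ g hg hg3 (η / 6) hη6
  obtain ⟨r₄, hr₄, H4⟩ := H4 σ hσ hσ4 Φ τ hτ χ hχ g hg hg4 (δ / 3 * (η / 6) ^ 2 / τ ^ 2) hς
  refine ⟨min (min r₁ r₂) (min r₃ r₄), lt_min (lt_min hr₁ hr₂) (lt_min hr₃ hr₄), ?_⟩
  intro r hr hrlt
  have hr1 : r < r₁ := lt_of_lt_of_le hrlt ((min_le_left _ _).trans (min_le_left _ _))
  have hr2 : r < r₂ := lt_of_lt_of_le hrlt ((min_le_left _ _).trans (min_le_right _ _))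
  have hr3 : r < r₃ := lt_of_lt_of_le hrlt ((min_le_right _ _).trans (min_le_left _ _))
  have hr4 : r < r₄ := lt_of_lt_of_le hrlt ((min_le_right _ _).trans (min_le_right _ _))
  -- truncation level (S1)
  obtain ⟨L₀, H1⟩ := H1 r hr hr1
  have hL₀ : L₀ ≤ max L₀ 1 := le_max_left _ _
  have hL1 : (1 : ℝ) ≤ max L₀ 1 := le_max_right _ _
  have hL0 : (0 : ℝ) ≤ max L₀ 1 := zero_le_one.trans hL1
  obtain ⟨N₁, H1⟩ := H1 (max L₀ 1) hL₀
  -- flight-time window (S2 and S3 each give a κ₀)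
  obtain ⟨κ₂, hκ₂, H2⟩ := H2 r hr hr2 (max L₀ 1) hL1
  obtain ⟨κ₃, hκ₃, H3⟩ := H3 r hr hr3 (max L₀ 1) hL1
  have hκpos : (0 : ℝ) < min (min (κ₂ / 2) (κ₃ / 2)) 1 := lt_min (lt_min (by positivity) (by positivity)) one_pos
  have hκlt2 : min (min (κ₂ / 2) (κ₃ / 2)) 1 < κ₂ :=
    lt_of_le_of_lt ((min_le_left _ _).trans (min_le_left _ _)) (by linarith)
  have hκlt3 : min (min (κ₂ / 2) (κ₃ / 2)) 1 < κ₃ :=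
    lt_of_le_of_lt ((min_le_left _ _).trans (min_le_right _ _)) (by linarith)
  have hκ1 : min (min (κ₂ / 2) (κ₃ / 2)) 1 ≤ (1 : ℝ) := min_le_right _ _
  obtain ⟨N₂, H2⟩ := H2 (min (min (κ₂ / 2) (κ₃ / 2)) 1) hκpos hκlt2
  obtain ⟨N₃, H3⟩ := H3 (min (min (κ₂ / 2) (κ₃ / 2)) 1) hκpos hκlt3
  obtain ⟨N₄, H4⟩ := H4 r hr hr4 (max L₀ 1) (min (min (κ₂ / 2) (κ₃ / 2)) 1) hL1 hκpos hκ1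
  refine ⟨max (max N₁ N₂) (max N₃ N₄), fun N hN => ?_⟩
  intro k l
  have hN1 : N₁ ≤ N := ((le_max_left _ _).trans (le_max_left _ _)).trans hN
  have hN2 : N₂ ≤ N := ((le_max_right _ _).trans (le_max_left _ _)).trans hN
  have hN3 : N₃ ≤ N := ((le_max_left _ _).trans (le_max_right _ _)).trans hN
  have hN4 : N₄ ≤ N := ((le_max_right _ _).trans (le_max_right _ _)).trans hN
  have E1 := H1 N hN1 k l
  have E2 := H2 N hN2 k l
  have E3 := H3 N hN3 k l
  have E4 : ∀ t ∈ Set.Icc (0 : ℝ) τ,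
      ProbabilityTheory.variance
        (fun z => evenTubeStat σ N χ g (evenMarkTrunc k l (max L₀ 1)) r (min (min (κ₂ / 2) (κ₃ / 2)) 1) t
          ((Φ N).flow t z))
        (localGibbsLaw σ a₀ u₀ θ₀ N (Φ N)) ≤ δ / 3 * (η / 6) ^ 2 / τ ^ 2 :=
    fun t ht => H4 N hN4 k l t ht
  -- regularity of W (S6) and the probability law, fed into S5
  obtain ⟨hmeas, B, hB⟩ := H6 σ N χ g k l (max L₀ 1) r (min (min (κ₂ / 2) (κ₃ / 2)) 1) τ hσ hχ hg hg6 hL0 hr hκpos.le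
  have hPN : IsProbabilityMeasure (localGibbsLaw σ a₀ u₀ θ₀ N (Φ N)) :=
    isProbabilityMeasure_localGibbsLaw ha hθ hu ha0 hθ0 hσhalf N (Φ N)
  have E5 := hS5 σ a₀ θ₀ u₀ N (Φ N) τ
    (fun t z => evenTubeStat σ N χ g (evenMarkTrunc k l (max L₀ 1)) r (min (min (κ₂ / 2) (κ₃ / 2)) 1) t z)
    (η / 6) (δ / 3 * (η / 6) ^ 2 / τ ^ 2) (η / 3) B hPN hmeas hB hτ hς.le (by linarith) E3 E4
  have hval : τ ^ 2 * (δ / 3 * (η / 6) ^ 2 / τ ^ 2) / (η / 3 - η / 6) ^ 2 = δ / 3 := by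
    field_simp
    ring
  rw [hval] at E5
  -- the union bound
  set P := localGibbsLaw σ a₀ u₀ θ₀ N (Φ N) with hP
  set D := fun z => evenStat σ N (Φ N) τ χ g (evenMark k l) r z with hD
  set DL := fun z => evenStat σ N (Φ N) τ χ g (evenMarkTrunc k l (max L₀ 1)) r z with hDL
  set T := fun z => evenTubeTimeStat σ N (Φ N) τ χ g (evenMarkTrunc k l (max L₀ 1)) r
    (min (min (κ₂ / 2) (κ₃ / 2)) 1) z with hT
  have E5' : P {z | η / 3 < |T z|} ≤ ENNReal.ofReal (δ / 3) := E5
  have hsub : {z | η < |D z|} ⊆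
      ({z | η / 3 < |D z - DL z|} ∪ {z | η / 3 < |DL z - T z|}) ∪ {z | η / 3 < |T z|} := by
    intro z hz
    simp only [Set.mem_setOf_eq, Set.mem_union] at hz ⊢
    by_contra hcon
    simp only [not_or, not_lt] at hcon
    obtain ⟨⟨h1, h2⟩, h3⟩ := hcon
    have i1 := abs_sub_abs_le_abs_sub (D z) (DL z)
    have i2 := abs_sub_abs_le_abs_sub (DL z) (T z)
    linarith
  calc P {z | η < |D z|}
      ≤ P (({z | η / 3 < |D z - DL z|} ∪ {z | η / 3 < |DL z - T z|}) ∪ {z | η / 3 < |T z|}) :=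
        measure_mono hsub
    _ ≤ P ({z | η / 3 < |D z - DL z|} ∪ {z | η / 3 < |DL z - T z|}) + P {z | η / 3 < |T z|} :=
        measure_union_le _ _
    _ ≤ (P {z | η / 3 < |D z - DL z|} + P {z | η / 3 < |DL z - T z|}) + P {z | η / 3 < |T z|} :=
        add_le_add (measure_union_le _ _) le_rfl
    _ ≤ (ENNReal.ofReal (δ / 3) + ENNReal.ofReal (δ / 3)) + ENNReal.ofReal (δ / 3) :=
        add_le_add (add_le_add E1 E2) E5'
    _ = ENNReal.ofReal δ := by
        rw [← ENNReal.ofReal_add hδ3.le hδ3.le, ← ENNReal.ofReal_add (by positivity) hδ3.le]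
        congr 1
        ring

/-- **The skeleton IS the crux proof modulo the registered stubs** (D-0027 §3.3 shape): sorry-free itself; its only gaps
are the open `stub_*` theorems above (matched by `EvenStressEnskog_of` against the statement `Prop`s `Stubs.stub_*` by
`rfl`-unfolding).  The equation of state `HsEosLowDensity` (stmt-0768) is no longer a hypothesis: it is PROVED in the tree
(`Theorems.hsEosLowDensity_proof`, `Theorems/ImplosionDichotomyHsEosLowDensity.lean`, p75216; the route decls
`ImplosionDichotomy.HsEosLowDensity` and `JParityClosure.HsEosLowDensity` have identical bodies). [folklore] -/
theorem EvenStressEnskog_proof : EvenStressEnskog :=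
  EvenStressEnskog_of stub_velocityTruncation stub_cylinderPullback stub_meanEnskog stub_fixedTimeVariance
    Summit.AtomisticToContinuum.HydrodynamicLimit.Theorems.hsEosLowDensity_proof

end

end Summit.AtomisticToContinuum.HydrodynamicLimit.Cruxes.EvenStressEnskog.EvenRungMeanVariance
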